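import Summits.BirchSwinnertonDyer.BirchSwinnertonDyer.Theorems.ByReductionTypeAtTwoSupersingularFlatPTLevelwise
import Summits.BirchSwinnertonDyer.BirchSwinnertonDyer.Theorems.ByReductionTypeAtTwoSupersingularFlatPTLimit
import Summits.BirchSwinnertonDyer.BirchSwinnertonDyer.Theorems.ByReductionTypeAtTwoSupersingularFlatFinLayer
import HarnessLib

/-!
# Route `ByReductionTypeAtTwo` (rung K4), crux `SupersingularRankZeroAtTwo` (item stmt-BirchSwinnertonDyer-19097), line
# `odd_blind_package` v2.18, stub `stub_flatPackage`, conjunct (8), clause F1♭ `Exact loc toX` — **T-LIM BY NAME**: «ker toX ⊆ range loc»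
# in its key-agnostic form `ORTH w ⟹ ∃ x ∈ 𝐇¹_Γ(T_pW), Col♭(L x) = Col♭(w)`, UNCONDITIONALLY — ONE `exact` of the Λ-adic passage ★★
# `SSFlatPT.exists_snd_coleman_apply_eq_of_levelwise` (p831689) with FIN := `finite_integralH1_torsion_allLayers` (p832982) and
# LEV := `levelwise_of_orth` (FILE 3) (cell `bsd-2adic`, seat `bsd-2adic-t42` GEN 50, hand hF1♭-LEV, FILE 4 = (D3); `--supports 19097`, helper)

HONEST FRAMING (D-0054): THEOREMS ONLY — no definition, no named fact, no instance, no notation, no `sorry`.  Helper toward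
conjunct (8): it discharges, by name, the two displayed inputs (LEV), (FIN) of the Λ-adic passage, so that tower-1's exactness consumer
`SSFlatPT.exists_snd_apply_eq_of_toX_eq_zero` (`…FlatExactAssembly`, p833046) receives its `hlim` from ONE name; closes NO stub; 19097 stays
OPEN on its 5 registered stubs (v2.18); nothing is booked; BSD₂ is proved for no supersingular curve and BSD for no curve by any of this;
typed ≠ proved.  Generic prime `p`, cyclotomic `κ`, `v ∣ p`; no ×2; key-agnostic (no `D`, `Y`, `ν`, `γ⁻¹`).

References: [Kato2004Asterisque] §8.2 (p. 181), §12.2 (p. 220), §17.13 (p. 279); [MilneADT2006] I Thm. 2.6, Thm. 4.10 (b);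
[GreenbergLNM1716] §4 p. 122; [Kobayashi2003] (8.23) (p. 18); [Sprung2012] Def. 7.9, 7.11 (p. 1503); [Rubin2000] App. B Prop. B.2.3.
-/

set_option autoImplicit false
-- the Theorems namespace of this sub repeats the summit name by design (D-0017 nested layout)
set_option linter.dupNamespace false

noncomputable section

open scoped Classical NumberField

namespace Summit.BirchSwinnertonDyer.BirchSwinnertonDyer.Theorems

namespace SSFlatPT

open CategoryTheory Field NumberField IsDedekindDomain WeierstrassCurve ContinuousCohomology
  Literature.NumberTheory.EllipticCurves Literature.NumberTheory.EllipticCurves.CyclotomicLayer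
  Literature.NumberTheory.EllipticCurves.Kobayashi2003 Literature.NumberTheory.EllipticCurves.Sprung2012
  Literature.NumberTheory.EllipticCurves.Sprung2017
  Literature.NumberTheory.EllipticCurves.GreenbergSelmer Literature.NumberTheory.EllipticCurves.Rank1Residual
  Literature.NumberTheory.EllipticCurves.Kato2004 Literature.NumberTheory.EllipticCurves.Kato2004.EulerSystemValues
  Literature.NumberTheory.GaloisRepresentations Literature.NumberTheory.GaloisRepresentations.DiscreteGaloisModule
  Literature.NumberTheory.GaloisCohomology Literature.NumberTheory.GaloisCohomology.PoitouTateFinite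
  ZpExtension Rat.HeightOneSpectrum Summit.BirchSwinnertonDyer.Rank1Residual.Supersingular
  SignedLowerOffTwo.PTDeep

variable (W : WeierstrassCurve ℚ) [W.IsElliptic] {p : ℕ} [Fact p.Prime] (κ : ZpExtension ℚ p) (v : HeightOneSpectrum (𝓞 ℚ))
  {ap : ℤ} {g : absoluteGaloisGroup (v.adicCompletion ℚ)} {c : ℕ → localPoints W (v.adicCompletion ℚ)}

/-! ## ★★ T-LIM by name: `ORTH w ⟹ ∃ x ∈ 𝐇¹_Γ(T_pW), Col♭(L x) = Col♭(w)` -/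

variable [ContinuousSMul ℤ_[p] (W.tateModule p)]

/-- ★★ **T-LIM («ker toX ⊆ range loc» of conjunct (8), key-agnostic), UNCONDITIONALLY**: for the cyclotomic `κ`, `v ∣ p`, a local `g`
restricting to a topological generator, `p ∣ a_p`, Honda levels `c_n ∈ E(ℚ_{n,v})` with the trace relations, a `Λ`-linear ♭ Coleman family
`J`, a pin `I : 𝐇¹_Γ(T_pW)`, any `L` with the displayed residue clause, and a functional `w` whose Kummer values on ♭-Selmer data vanish
(ORTH, VERBATIM the antecedent of `hlim` in tower-1's consumer `SSFlatPT.exists_snd_apply_eq_of_toX_eq_zero`): `∃ x : I.H, Col♭(L x) = Col♭(w)`.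
ONE `exact` of ★★ `exists_snd_coleman_apply_eq_of_levelwise` (p831689) with FIN := `finite_integralH1_torsion_allLayers` (p832982) and
LEV := `levelwise_of_orth`. [cite: Kato2004Asterisque, §8.2 (p. 181), §12.2 (p. 220), §17.13 (p. 279)] [cite: MilneADT2006, Ch. I Thm. 4.10 (b)]
[cite: GreenbergLNM1716, §4 p. 122] [cite: Kobayashi2003, (8.23) (p. 18)] [cite: Sprung2012, Def. 7.9 (p. 1503)] -/
theorem exists_snd_coleman_apply_eq_of_orth (hκ : κ.IsCyclotomic) (hv : (p : 𝓞 ℚ) ∈ v.asIdeal)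
    (hg : κ.IsTopGenerator (resGalOfEmb (closureEmb (K := ℚ) (v.adicCompletion ℚ)) g)) (hap : (p : ℤ) ∣ ap)
    (hc : ∀ n, c n ∈ localLayerPointsOfEmb κ (closureEmb (K := ℚ) (v.adicCompletion ℚ)) W n)
    (hTr : ∀ n, 1 ≤ n → localTraceOfEmb κ (closureEmb (K := ℚ) (v.adicCompletion ℚ)) W n (n + 1) (c (n + 1)) =
      ap • c n - c (n - 1))
    (J : letI := moduleOfGenerator κ (closureEmb (K := ℚ) (v.adicCompletion ℚ)) W hg
      (localTowerPointsOfEmb κ (closureEmb (K := ℚ) (v.adicCompletion ℚ)) W →+ ℤ_[p]) →ₗ[IwasawaAlgebra p]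
        IwasawaAlgebra p × IwasawaAlgebra p)
    (hJ : ∀ z, IsColemanPair κ (closureEmb (K := ℚ) (v.adicCompletion ℚ)) W ap g c z (J z).1 (J z).2)
    {γ : absoluteGaloisGroup ℚ} (I : IwasawaH1Data W p κ γ)
    (L : I.H → (localTowerPointsOfEmb κ (closureEmb (K := ℚ) (v.adicCompletion ℚ)) W →+ ℤ_[p]))
    (hL : ∀ (x : I.H) (n k : ℕ) (Q : localPoints W (v.adicCompletion ℚ))
        (hQ : Q ∈ localLayerPointsOfEmb κ (closureEmb (K := ℚ) (v.adicCompletion ℚ)) W n),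
        PadicInt.toZModPow k (L x ⟨Q, localLayerPointsOfEmb_le_localTowerPointsOfEmb κ _ W n hQ⟩) =
          CyclotomicLayer.tatePairingPk W κ v n k (I.proj n x) ⟨Q, hQ⟩)
    (w : localTowerPointsOfEmb κ (closureEmb (K := ℚ) (v.adicCompletion ℚ)) W →+ ℤ_[p])
    (hw : ∀ (s : sharpFlatSelmerInfty W κ (closureEmb (K := ℚ) (v.adicCompletion ℚ)) ap g c .flat)
      (φ : contOneCocycles (discreteTopRep κ.kerSubgroup (W.geomPrimaryTorsion p)))
      (Q : localPoints W (v.adicCompletion ℚ)) (k : ℕ)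
      (hQ : (p ^ k) • Q ∈ localTowerPointsOfEmb κ (closureEmb (K := ℚ) (v.adicCompletion ℚ)) W),
      oneCocycleClass (discreteTopRep κ.kerSubgroup (W.geomPrimaryTorsion p)) φ = (s : W.subgroupH1 p κ.kerSubgroup) →
      (∀ τ : localSubgroupOfEmb κ.kerSubgroup (closureEmb (K := ℚ) (v.adicCompletion ℚ)),
        pointsMapOfEmb W (closureEmb (K := ℚ) (v.adicCompletion ℚ))
            ((φ.1 (resGalSubgroupOfEmb κ.kerSubgroup _ τ) : W.geomPrimaryTorsion p) : W.geomPoints) =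
          (τ : absoluteGaloisGroup (v.adicCompletion ℚ)) • Q - Q) →
      PadicInt.toZModPow k (w ⟨(p ^ k) • Q, hQ⟩) = 0) :
    ∃ x : I.H, (J (L x)).2 = (J w).2 :=
  exists_snd_coleman_apply_eq_of_levelwise W κ v hκ hv hg hap hc hTr J hJ I L hL w (finite_integralH1_torsion_allLayers W κ)
    (levelwise_of_orth W κ v hκ hv hg hap hc hTr w hw)

end SSFlatPT

end Summit.BirchSwinnertonDyer.BirchSwinnertonDyer.Theorems

end
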